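import Summits.QuantumFields.BalabanUV.T4Continuum.Spine.NE4.AutonomousScheme
import Summits.QuantumFields.BalabanUV.T4Continuum.Spine.NE4.FadingFromRateAnalyticSharp

/-!
# Spine/NE4/AutonomousSchemeFlag — companion of `AutonomousScheme` (census (R42)): `T4FlagMemory.StepShift` DERIVED under the flag
# embedding, what the flag renewal recovers from the same data (every rate `ρ > θ`, never `θ`), and the affine witness (= the
# geometric tower) attaining rate and constant

Cell `pub-balaban-gaps` (YM blitz G2), seat `ne4`, generation 9 (unit `pub-balaban-gaps-ne4-g9`); record `HOME/ne/NE4.md` §5 (R42).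
HONEST FRAMING as in `AutonomousScheme`: hypothesis shapes about an ABSTRACT one-step map + elementary bookkeeping + a toy on `ℝ`;
NE4 (`T4CouplingMatching.ScaleShiftRate`, NOT IN PRINT — [Balaban1987RG1] = CMP **109** p. 264) is NOT proved; nothing of Bałaban's is
asserted; no status word moves.  One finite T⁴; NOT ℝ⁴, NOT infinite volume, NOT a mass gap, NOT Clay.

* §4 THE FLAG EMBEDDING — `StepShift` DERIVED.  `toFlag A ξ` realises the Markov scheme of `AutonomousScheme` as a `T4FlagMemory`
  scheme ([Balaban1987RG1] (0.23) p. 256: the growing flag; here the step reads only the newest old entry and is the SAME map at every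
  step — [Balaban1988Convergent] = CMP **119** p. 262 «successive applications of the operations RT»); `entry_toFlag`: its entries ARE
  the states; `represents_toFlag_iff`; **`stepShift_toFlag`**: `T4FlagMemory.StepShift (toFlag A ξ) γ src` holds with `src 0 = θ·D` and
  `src k = 0` for every `k ≥ 1` — from the second step on the one-step source of the scale shift VANISHES IDENTICALLY (the step-(k+1)
  map and the step-k map are the same function reading the same entry); in `T4FlagMemory` that source is an independent unprinted
  INPUT (cell rows NE2∕NE3∕NE5: the η-differences of the one-step objects).  `scaleShiftRate_via_flag`: feeding the embedded data into
  `T4FlagMemory.scaleShiftRate_of_scheme` recovers only every rate `ρ > θ`, constant `cr·θD·(ρ+θ)∕(ρ−θ)`; the direct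
  `Markov.scaleShiftRate_of_markov` gives `θ` itself with constant `cr·D·θ`.
* §5 WITNESS ∕ SHARPNESS.  The affine scheme `affine θ g x = θx + g` on `ℝ` from `ξ = 0` with `r = id` satisfies every shape globally
  (`θ`, `ℓ = 1`, `D = γ`) and REPRESENTS the geometric tower `tower θ` of `FadingFromRateAnalyticSharp` (census (R34): the extremal
  family of the analytic rung IS the β-family of the simplest autonomous scheme); `tower_shift_eq`: its scale shift is EXACTLY
  `θ^{k+1}·w₀` — the unpartnered bare coupling weighted by its age (cf. `T4FlagMemory.linStep_shift_eq`); `markov_rate_exact`: the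
  constant `γθ` and the rate `θ` of `scaleShiftRate_of_markov` are both attained; `markov_moduli_exact`: the delivered history moduli `θ^{k−i}` are
  exact in the oldest coupling (`moduli_lower_tower`).
-/

namespace Summit.QuantumFields.BalabanUV.T4Continuum.Spine.NE4

open Literature.MathematicalPhysics.QuantumFieldTheory.Balaban1983to89
open Literature.MathematicalPhysics.QuantumFieldTheory.Balaban1983to89.FlowStep
open Literature.MathematicalPhysics.QuantumFieldTheory.Balaban1983to89.T4CouplingMatching
  (ScaleShiftRate HistLipschitz FadingMemory)
open Literature.MathematicalPhysics.QuantumFieldTheory.Balaban1983to89.T4FlagMemory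
  (extd extd_coe extd_adm extd_tail tail_mem_box Adm ReadLipschitz StepShift StepMemory Represents entry flag flag_apply
    entry_def)
open Finset

namespace Markov

/-! ## §4 The flag embedding: `T4FlagMemory.StepShift` DERIVED (source `θ·D` at the first step, `0` ever after) -/

section Flag

variable {X : Type*} [PseudoMetricSpace X] [Inhabited X] {A : ℝ → X → X} {S : Set X} {ξ : X} {r : X → ℝ}
  {β : HBeta} {θ D γ cr : ℝ}

/-- The Markov scheme as a `T4FlagMemory` scheme: the step-j map reads ONLY the newest old entry (position `j − 1` of the flag; the
bare state at `j = 0`) and applies the SAME map `A` at every step. [folklore] -/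
def toFlag (A : ℝ → X → X) (ξ : X) : ℕ → ℝ → (ℕ → X) → X :=
  fun j g F => A g (if j = 0 then ξ else F (j - 1))

omit [PseudoMetricSpace X] in
/-- [bookkeeping] THE ENTRIES OF THE EMBEDDED SCHEME ARE THE STATES: `entry (toFlag A ξ) g j = state A ξ g (j+1)`. [folklore] -/
@[simp] theorem entry_toFlag (A : ℝ → X → X) (ξ : X) (g : ℕ → ℝ) :
    ∀ j, entry (toFlag A ξ) g j = state A ξ g (j + 1) := by
  intro j
  induction j with
  | zero => simp [entry_def, toFlag]
  | succ j ih =>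
    rw [entry_def]
    simp only [toFlag, Nat.succ_ne_zero, if_false, Nat.add_sub_cancel]
    rw [flag_apply, if_pos (Nat.lt_succ_self j), ih]
    rfl

omit [PseudoMetricSpace X] in
/-- [bookkeeping] The two representation hypotheses coincide under the embedding. [folklore] -/
theorem represents_toFlag_iff : Represents (toFlag A ξ) r γ β ↔ RepresentsAut A r ξ γ β := by
  unfold Represents RepresentsAut
  simp only [entry_toFlag]

/-- **`StepShift` DERIVED.**  Under `Invariant` (∋ ξ), `StateContraction A S θ γ` (`θ ≥ 0`) and `FirstStep A ξ D γ`, the embedded scheme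
satisfies `T4FlagMemory.StepShift (toFlag A ξ) γ src` with `src 0 = θ·D` and `src k = 0` for `k ≥ 1`: from the second step on, the
step-(k+1) map applied to run B's flag and the step-k map applied to run B's SHIFTED flag are the same function of the same entry, so
the one-step source of the scale shift VANISHES; at the first step it is the contracted displacement of the bare state.  In
`T4FlagMemory` this source is an independent unprinted INPUT (cell rows NE2∕NE3∕NE5). [folklore] -/
theorem stepShift_toFlag (hθ : 0 ≤ θ) (hInv : Invariant A S γ) (hξ : ξ ∈ S)
    (hcon : StateContraction A S θ γ) (hfirst : FirstStep A ξ D γ) :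
    StepShift (toFlag A ξ) γ (fun k => if k = 0 then θ * D else 0) := by
  intro g hg k
  rcases k with _ | k
  · simp only [entry_toFlag, toFlag, if_true, state_succ, state_zero]
    calc dist (A (g 1) (A (g 0) ξ)) (A (g 1) ξ)
        ≤ θ * dist (A (g 0) ξ) ξ :=
          hcon _ (hg 1).1 (hg 1).2 _ (hInv _ (hg 0).1 (hg 0).2 _ hξ) _ hξ
      _ ≤ θ * D := mul_le_mul_of_nonneg_left (hfirst _ (hg 0).1 (hg 0).2) hθ
  · simp only [entry_toFlag, toFlag, Nat.succ_ne_zero, if_false, Nat.add_sub_cancel, Nat.lt_succ_self, if_true]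
    simp

/-- **WHAT THE FLAG RENEWAL RECOVERS FROM THE SAME DATA: every rate `ρ > θ`, never `θ`.**  Feeding the embedded scheme — global
contraction `θ`, hence the ONE-ENTRY functional memory `M′ j m = θ·[m + 1 = j]` (`T4FlagMemory.StepMemory`), and the DERIVED source
`src = (θD, 0, 0, …)` of `stepShift_toFlag` — into `T4FlagMemory.scaleShiftRate_of_scheme` with `ω = (ρ−θ)∕2`, `C′ = 2θ∕(ρ−θ)` (so that
`θ ≤ C′ω` and `(1 + C′)ω = (ρ+θ)∕2 < ρ`) gives `ScaleShiftRate (cr·θD(ρ+θ)∕(ρ−θ)) ρ γ β` for every `ρ > θ`, the constant blowing up as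
`ρ ↓ θ`; the direct `scaleShiftRate_of_markov` gives the rate `θ` itself with constant `cr·D·θ`.  (No contradiction with
`T4BetaMemorySharp`: the renewal threshold is sharp over ALL flag data; Markov-state data are special.) [folklore] -/
theorem scaleShiftRate_via_flag {ρ : ℝ} (hθ : 0 ≤ θ) (hθρ : θ < ρ) (hcr : 0 ≤ cr) (hD : 0 ≤ D)
    (hconG : ∀ (g : ℝ) (x y : X), dist (A g x) (A g y) ≤ θ * dist x y) (hfirst : FirstStep A ξ D γ)
    (hrep : RepresentsAut A r ξ γ β) (hr : ReadLipschitz r cr) :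
    ScaleShiftRate (cr * (θ * D * (ρ + θ) / (ρ - θ))) ρ γ β := by
  have hne : ρ - θ ≠ 0 := by linarith
  have hρ0 : 0 ≤ ρ := hθ.trans hθρ.le
  have hω : 0 ≤ (ρ - θ) / 2 := by linarith
  have hC' : 0 ≤ 2 * θ / (ρ - θ) := div_nonneg (by linarith) (by linarith)
  have hconU : StateContraction A Set.univ θ γ := fun g _ _ x _ y _ => hconG g x y
  have hInvU : Invariant A Set.univ γ := fun _ _ _ _ _ => Set.mem_univ _
  -- the one-entry functional memory of the embedded scheme
  have hmem : StepMemory (toFlag A ξ) (fun j m => if m + 1 = j then θ else 0) := by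
    intro j g y y'
    rcases j with _ | j
    · simp [toFlag]
    · simp only [toFlag, Nat.succ_ne_zero, if_false, Nat.add_sub_cancel]
      rw [Finset.sum_eq_single_of_mem j (mem_range.mpr (Nat.lt_succ_self j))
        (fun m _ hm => by rw [if_neg (by omega), zero_mul])]
      rw [if_pos rfl]
      exact hconG g (y j) (y' j)
  have hCω : 2 * θ / (ρ - θ) * ((ρ - θ) / 2) = θ := by
    field_simp
  have hM' : FadingMemory (2 * θ / (ρ - θ)) ((ρ - θ) / 2) (fun j m => if m + 1 = j then θ else 0) := by
    intro j m _
    show 0 ≤ (if m + 1 = j then θ else 0) ∧ (if m + 1 = j then θ else 0) ≤ 2 * θ / (ρ - θ) * ((ρ - θ) / 2) ^ (j - m)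
    by_cases h : m + 1 = j
    · subst h
      rw [if_pos rfl, Nat.add_sub_cancel_left, pow_one, hCω]
      exact ⟨hθ, le_rfl⟩
    · rw [if_neg h]
      exact ⟨le_rfl, mul_nonneg hC' (pow_nonneg hω _)⟩
  have hsm_eq : (1 + 2 * θ / (ρ - θ)) * ((ρ - θ) / 2) = (ρ + θ) / 2 := by
    field_simp
    ring
  have hsmall : (1 + 2 * θ / (ρ - θ)) * ((ρ - θ) / 2) < ρ := by
    rw [hsm_eq]
    linarith
  have hsh := stepShift_toFlag hθ hInvU (Set.mem_univ ξ) hconU hfirst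
  have hsrc : ∀ k, (fun k => if k = 0 then θ * D else (0 : ℝ)) k ≤ θ * D * ρ ^ k := by
    intro k
    rcases k with _ | k
    · simp
    · simp only [Nat.succ_ne_zero, if_false]
      exact mul_nonneg (mul_nonneg hθ hD) (pow_nonneg hρ0 _)
  have hrepF : Represents (toFlag A ξ) r γ β := represents_toFlag_iff.mpr hrep
  have h := T4FlagMemory.scaleShiftRate_of_scheme hC' hω hcr (mul_nonneg hθ hD) hsmall hrepF hr hmem hM' hsh hsrc
  rw [hsm_eq] at h
  have e1 : ρ - (ρ - θ) / 2 = (ρ + θ) / 2 := by ring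
  have e2 : ρ - (ρ + θ) / 2 = (ρ - θ) / 2 := by ring
  have key : cr * (θ * D * (ρ - (ρ - θ) / 2) / (ρ - (ρ + θ) / 2)) = cr * (θ * D * (ρ + θ) / (ρ - θ)) := by
    rw [e1, e2]
    field_simp
  rw [key] at h
  exact h

end Flag

/-! ## §5 Witness and sharpness: the affine scheme represents the geometric tower; rate and constant attained -/

section Witness

/-- THE AFFINE SCHEME on `ℝ`: `A g x = θx + g` (contract by `θ`, inject the current coupling).  A toy inhabitant of the shapes, not a
model of [Balaban1987RG1] (2.13). [folklore] -/
def affine (θ : ℝ) : ℝ → ℝ → ℝ := fun g x => θ * x + g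

/-- [bookkeeping] Every set is invariant for a map into `Set.univ`. [folklore] -/
theorem invariant_affine (θ γ : ℝ) : Invariant (affine θ) Set.univ γ := fun _ _ _ _ _ => Set.mem_univ _

/-- The affine scheme contracts by `θ` globally. [folklore] -/
theorem stateContraction_affine {θ : ℝ} (hθ : 0 ≤ θ) (γ : ℝ) : StateContraction (affine θ) Set.univ θ γ := by
  intro g _ _ x _ y _
  simp only [affine, Real.dist_eq]
  rw [show θ * x + g - (θ * y + g) = θ * (x - y) by ring, abs_mul, abs_of_nonneg hθ]

/-- The affine scheme is `1`-Lipschitz in its coupling. [folklore] -/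
theorem stateCouplingLipschitz_affine (θ γ : ℝ) : StateCouplingLipschitz (affine θ) Set.univ 1 γ := by
  intro g g' _ _ _ _ x _
  simp only [affine, Real.dist_eq, one_mul]
  rw [show θ * x + g - (θ * x + g') = g - g' by ring]

/-- The first step of the affine scheme from `0` moves by the bare coupling, `≤ γ`. [folklore] -/
theorem firstStep_affine (θ : ℝ) {γ : ℝ} : FirstStep (affine θ) 0 γ γ := by
  intro g hg0 hgγ
  simp only [affine, mul_zero, zero_add, Real.dist_eq, sub_zero]
  rwa [abs_of_pos hg0]

/-- [bookkeeping] The states of the affine scheme from `0`: `state (affine θ) 0 g (j+1) = Σ_{i≤j} θ^{j−i} g_i`. [folklore] -/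
theorem state_affine (θ : ℝ) (g : ℕ → ℝ) :
    ∀ j, state (affine θ) 0 g (j + 1) = ∑ i ∈ range (j + 1), θ ^ (j - i) * g i := by
  intro j
  induction j with
  | zero => simp [affine]
  | succ j ih =>
    rw [state_succ, ih]
    simp only [affine]
    rw [Finset.sum_range_succ _ (j + 1), Nat.sub_self, pow_zero, one_mul, Finset.mul_sum]
    congr 1
    refine Finset.sum_congr rfl fun i hi => ?_
    have hij : i ≤ j := Nat.lt_succ_iff.mp (mem_range.mp hi)
    rw [show j + 1 - i = (j - i) + 1 by omega, pow_succ]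
    ring

/-- **THE GEOMETRIC TOWER IS THE β-FAMILY OF THE AFFINE SCHEME**: `RepresentsAut (affine θ) id 0 γ (tower θ)` — the extremal family of
the analytic rung (`FadingFromRateAnalyticSharp.tower`, census (R34)) is generated by the simplest autonomous scheme. [folklore] -/
theorem representsAut_affine_tower (θ γ : ℝ) : RepresentsAut (affine θ) id 0 γ (tower θ) := by
  intro k v _
  rw [id, state_affine, ← Fin.sum_univ_eq_sum_range]
  simp only [tower, extd_coe]

/-- NE4 for the tower from the autonomous theorem: `ScaleShiftRate (γθ) θ γ (tower θ)` (`cr = 1`, `D = γ`). [folklore] -/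
theorem scaleShiftRate_tower_markov {θ γ : ℝ} (hθ : 0 ≤ θ) : ScaleShiftRate (γ * θ) θ γ (tower θ) := by
  have h := scaleShiftRate_of_markov (S := Set.univ) hθ zero_le_one (invariant_affine θ γ) (Set.mem_univ _)
    (stateContraction_affine hθ γ) (firstStep_affine θ) (representsAut_affine_tower θ γ)
    (readLipschitzOn_of_readLipschitz T4FlagMemory.readLipschitz_id _)
  simpa using h

/-- [bookkeeping] THE SCALE SHIFT OF THE TOWER IS EXACTLY THE UNPARTNERED BARE COUPLING WEIGHTED BY ITS AGE:
`tower θ (k+1) w − tower θ k (Fin.tail w) = θ^{k+1}·w 0`. [folklore] -/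
theorem tower_shift_eq (θ : ℝ) (k : ℕ) (w : Fin (k + 2) → ℝ) :
    tower θ (k + 1) w - tower θ k (Fin.tail w) = θ ^ (k + 1) * w 0 := by
  simp only [tower]
  rw [Fin.sum_univ_succ]
  simp only [Fin.val_zero, Nat.sub_zero, Fin.val_succ, Fin.tail]
  have e : ∑ i : Fin (k + 1), θ ^ (k + 1 - ((i : ℕ) + 1)) * w i.succ = ∑ i : Fin (k + 1), θ ^ (k - (i : ℕ)) * w i.succ :=
    Finset.sum_congr rfl fun i _ => by rw [Nat.add_sub_add_right]
  rw [e]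
  ring

/-- **RATE AND CONSTANT OF `scaleShiftRate_of_markov` ARE ATTAINED** (`0 < θ`, `0 < γ`): the tower has `ScaleShiftRate (γθ) θ γ`, NO
smaller constant at rate `θ`, and NO rate `θ′ ∈ [0, θ[` with any constant. [folklore] -/
theorem markov_rate_exact {θ γ : ℝ} (hθ : 0 < θ) (hγ : 0 < γ) :
    ScaleShiftRate (γ * θ) θ γ (tower θ) ∧
    (∀ c, c < γ * θ → ¬ ScaleShiftRate c θ γ (tower θ)) ∧
    (∀ θ' c, 0 ≤ θ' → θ' < θ → ¬ ScaleShiftRate c θ' γ (tower θ)) := by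
  have hconst : ∀ k, (fun _ : Fin (k + 2) => γ) ∈ Box γ (k + 1) := fun k =>
    mem_box.mpr fun _ => ⟨hγ, le_rfl⟩
  have hshift : ∀ k, |tower θ (k + 1) (fun _ : Fin (k + 2) => γ) - tower θ k (Fin.tail fun _ : Fin (k + 2) => γ)|
      = γ * θ ^ (k + 1) := fun k => by
    rw [tower_shift_eq, abs_of_nonneg (mul_nonneg (pow_nonneg hθ.le _) hγ.le), mul_comm]
  refine ⟨scaleShiftRate_tower_markov hθ.le, fun c hc h => ?_, fun θ' c hθ'0 hθ'θ h => ?_⟩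
  · have h0 := h 0 _ (hconst 0)
    rw [hshift 0] at h0
    simp only [zero_add, pow_one, pow_zero, mul_one] at h0
    linarith
  · -- `γθ^{k+1} ≤ cθ′^k` for all k is impossible when `0 ≤ θ′ < θ`
    have hc0 : 0 < c := by
      have h0 := h 0 _ (hconst 0)
      rw [hshift 0] at h0
      simp only [zero_add, pow_one, pow_zero, mul_one] at h0
      nlinarith
    have hq1 : θ' / θ < 1 := (div_lt_one hθ).mpr hθ'θ
    obtain ⟨k, hk⟩ := exists_pow_lt_of_lt_one (div_pos (mul_pos hγ hθ) hc0) hq1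
    have hkk := h k _ (hconst k)
    rw [hshift k] at hkk
    -- hkk : γ θ^{k+1} ≤ c θ′^k ; hk : (θ′/θ)^k < γθ/c
    have hθk : 0 < θ ^ k := pow_pos hθ k
    have h1 : c * θ' ^ k = c * (θ' / θ) ^ k * θ ^ k := by
      rw [div_pow, mul_assoc, div_mul_cancel₀ _ hθk.ne']
    have h2 : c * (θ' / θ) ^ k < γ * θ := by
      have := mul_lt_mul_of_pos_left hk hc0
      rwa [mul_div_cancel₀ _ hc0.ne'] at this
    have h3 : c * θ' ^ k < γ * θ ^ (k + 1) := by
      rw [h1, pow_succ]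
      calc c * (θ' / θ) ^ k * θ ^ k < γ * θ * θ ^ k := mul_lt_mul_of_pos_right h2 hθk
        _ = γ * (θ ^ k * θ) := by ring
    linarith

/-- The autonomous moduli of the tower are EXACT in the oldest coupling: `histLipschitz_of_markov` delivers `Λ k i = θ^{k−i}` (`cr = ℓ = 1`), and
every admissible modulus has `θ^k ≤ Λ k 0` (`moduli_lower_tower`). [folklore] -/
theorem markov_moduli_exact {θ γ : ℝ} (hθ : 0 ≤ θ) (hγ : 0 < γ) :
    HistLipschitz (fun k i => θ ^ (k - i)) γ (tower θ) ∧
    ∀ Λ : ℕ → ℕ → ℝ, HistLipschitz Λ γ (tower θ) → ∀ k, θ ^ k ≤ Λ k 0 := by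
  refine ⟨?_, fun Λ hΛ k => moduli_lower_tower hγ hθ hΛ k⟩
  have h := histLipschitz_of_markov (S := Set.univ) hθ zero_le_one (invariant_affine θ γ) (Set.mem_univ _)
    (stateContraction_affine hθ γ) (stateCouplingLipschitz_affine θ γ) (representsAut_affine_tower θ γ)
    (readLipschitzOn_of_readLipschitz T4FlagMemory.readLipschitz_id _)
  simpa using h

end Witness


end Markov

end Summit.QuantumFields.BalabanUV.T4Continuum.Spine.NE4
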